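import Summits.AtomisticToContinuum.Crystallization.Theorems.MinimisingLawsHaveAtoms.Negative.DiffuseFamilyLaws
import Summits.AtomisticToContinuum.Crystallization.Theorems.MinimiserShells.Negative.LoadBearing
import Mathlib.Analysis.SpecialFunctions.Exp

/-!
# Negative knowledge for crux `MinimisingLawsHaveAtoms` (stmt-AtomisticToContinuum-15776), V:
# the rooted comb with a far symmetric pair — point-stationarity is load-bearing

Standing crux disprover `cdisprove-stmt-AtomisticToContinuum-15776`,
`--supports stmt-AtomisticToContinuum-15776`; instance of the machine of Part II
(`DiffuseFamilyLaws.lean`), definition-free.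

`minimisingLawsHaveAtoms_false_without_pointStationarity`: WITHOUT the Mecke / mass-transport
identity the crux `IsometryAtoms.MinimisingLawsHaveAtoms` is FALSE.  Witness family: the landed
rooted COMB `comb combSize` of `MinimiserShells.Negative.LoadBearing` (root plus `combSize` collinear
teeth at distances in `[3/2, 2)`, root energy `≤ e*` whatever the value of `e*`,
`rootEnergy_comb_le_eStar`) decorated with the far symmetric pair `±(10 + eᵗ) e₁`:
* each member is a rooted `δ`-hard-core configuration, `δ = 1/(2(combSize+1))` (`combPair_separated`),
  of root energy `rootEnergy(comb) + V_LJ(10 + eᵗ) ≤ e*` (`rootEnergy_combPair_le`) — the root buys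
  an energy `≤ e*` with many teeth, which LJ stability forbids ON AVERAGE over the root
  (a point-stationary law prices the teeth too) but which a rooted sample may carry;
* the family is continuous in the local rubber metric and separated by the DIAMETER
  (`diam_combPair : diam = 2(10 + eᵗ)`, an isometry invariant), so by Part II its law (`t` uniform
  on `[0,1]`) is an a.s. `δ`-hard-core probability law with `E[h] ≤ e*` charging NO rooted isometry
  class — and it is of course not point-stationary.
Moral: without the Mecke identity nothing ties the root's energy to the energy per particle, and
isometry-diffuseness is then free.  All `[folklore]`.
-/

noncomputable section

namespace Summit.AtomisticToContinuum.Crystallization.Theorems.MinimisingLawsHaveAtoms.Negative.RootedCombPair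

open MeasureTheory Set Filter Metric Function
open scoped ENNReal Topology
open Literature.MathematicalPhysics.StatisticalMechanics Literature.Probability.Process
open Literature.Probability.Process.LocalConfig
open Summit.AtomisticToContinuum.Crystallization.Theorems.MinimisingLawsHaveAtoms.Negative.DiffuseFamilyLaws
open Summit.AtomisticToContinuum.Crystallization.Theorems.MinimiserShells.Negative.LoadBearing
  (e0 combPt comb combSize norm_combPt_le comb_separated rootEnergy_comb_le_eStar combPt_ne_zero)

/-! ## §1 The comb and the far pair -/

/-- Every point of the comb has norm `≤ 2`. [folklore] -/
theorem norm_le_two_of_mem_comb {m : ℕ} {y : EuclideanSpace ℝ (Fin 3)} (hy : y ∈ comb m) :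
    ‖y‖ ≤ 2 := by
  simp only [comb, Finset.mem_insert, Finset.mem_image, Finset.mem_range] at hy
  rcases hy with rfl | ⟨k, hk, rfl⟩
  · simp
  · exact norm_combPt_le hk
/-- The far point `(10 + eᵗ) e₁` has norm `10 + eᵗ`. [folklore] -/
theorem norm_far (t : ℝ) :
    ‖(10 + Real.exp t) • EuclideanSpace.single (1 : Fin 3) (1 : ℝ)‖ = 10 + Real.exp t := by
  have h1 : ‖EuclideanSpace.single (1 : Fin 3) (1 : ℝ)‖ = 1 := by simp
  rw [norm_smul, h1, mul_one, Real.norm_of_nonneg (by positivity)]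

/-- `10 < 10 + eᵗ`. [folklore] -/
theorem ten_lt_far (t : ℝ) : (10 : ℝ) < 10 + Real.exp t := by linarith [Real.exp_pos t]
/-- The far point is not in the comb (its norm exceeds `2`). [folklore] -/
theorem far_not_mem_comb (t : ℝ) (m : ℕ) :
    (10 + Real.exp t) • EuclideanSpace.single (1 : Fin 3) (1 : ℝ) ∉ comb m := fun h => by
  have := norm_le_two_of_mem_comb h
  rw [norm_far] at this
  linarith [ten_lt_far t]
/-- Neither is its negative. [folklore] -/
theorem neg_far_not_mem_comb (t : ℝ) (m : ℕ) :
    -((10 + Real.exp t) • EuclideanSpace.single (1 : Fin 3) (1 : ℝ)) ∉ comb m := fun h => by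
  have := norm_le_two_of_mem_comb h
  rw [norm_neg, norm_far] at this
  linarith [ten_lt_far t]
/-- The two far points differ. [folklore] -/
theorem far_ne_neg_far (t : ℝ) :
    (10 + Real.exp t) • EuclideanSpace.single (1 : Fin 3) (1 : ℝ) ≠
      -((10 + Real.exp t) • EuclideanSpace.single (1 : Fin 3) (1 : ℝ)) := fun h => by
  have h2 : (2 : ℝ) • ((10 + Real.exp t) • EuclideanSpace.single (1 : Fin 3) (1 : ℝ)) = 0 := by
    rw [two_smul]
    nth_rewrite 2 [h]
    exact add_neg_cancel _
  rw [smul_eq_zero] at h2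
  rcases h2 with h2 | h2
  · norm_num at h2
  · have := norm_far t
    rw [h2, norm_zero] at this
    linarith [ten_lt_far t]

/-- The far point is not in the comb with its negative adjoined. [folklore] -/
theorem far_not_mem_insert (t : ℝ) (m : ℕ) :
    (10 + Real.exp t) • EuclideanSpace.single (1 : Fin 3) (1 : ℝ) ∉
      insert (-((10 + Real.exp t) • EuclideanSpace.single (1 : Fin 3) (1 : ℝ))) (comb m) := by
  rw [Finset.mem_insert, not_or]
  exact ⟨far_ne_neg_far t, far_not_mem_comb t m⟩
/-- Distance between the two far points: `2(10 + eᵗ)`. [folklore] -/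
theorem dist_far_neg_far (t : ℝ) :
    dist ((10 + Real.exp t) • EuclideanSpace.single (1 : Fin 3) (1 : ℝ))
      (-((10 + Real.exp t) • EuclideanSpace.single (1 : Fin 3) (1 : ℝ))) = 2 * (10 + Real.exp t) := by
  rw [dist_eq_norm, sub_neg_eq_add, ← two_smul ℝ, norm_smul, norm_far, Real.norm_two]
/-- A far point and a comb point are at distance `≥ 8`. [folklore] -/
theorem eight_le_dist_far_comb (t : ℝ) {m : ℕ} {x y : EuclideanSpace ℝ (Fin 3)}
    (hx : ‖x‖ = 10 + Real.exp t) (hy : y ∈ comb m) : 8 ≤ dist x y := by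
  rw [dist_eq_norm]
  linarith [ten_lt_far t, norm_sub_norm_le x y, norm_le_two_of_mem_comb hy]
/-- Membership in the decorated comb `{u, −u} ∪ comb`. [folklore] -/
theorem mem_combPair_iff {t : ℝ} {m : ℕ} {x : EuclideanSpace ℝ (Fin 3)} :
    x ∈ insert ((10 + Real.exp t) • EuclideanSpace.single (1 : Fin 3) (1 : ℝ))
        (insert (-((10 + Real.exp t) • EuclideanSpace.single (1 : Fin 3) (1 : ℝ))) (comb m)) ↔
      x = (10 + Real.exp t) • EuclideanSpace.single (1 : Fin 3) (1 : ℝ) ∨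
      x = -((10 + Real.exp t) • EuclideanSpace.single (1 : Fin 3) (1 : ℝ)) ∨ x ∈ comb m := by
  simp only [Finset.mem_insert]
/-- **The decorated comb is `1/(2(m+1))`-separated.** [folklore] -/
theorem combPair_separated (t : ℝ) (m : ℕ) :
    ∀ x ∈ (↑(insert ((10 + Real.exp t) • EuclideanSpace.single (1 : Fin 3) (1 : ℝ))
        (insert (-((10 + Real.exp t) • EuclideanSpace.single (1 : Fin 3) (1 : ℝ))) (comb m))) :
          Set (EuclideanSpace ℝ (Fin 3))),
    ∀ y ∈ (↑(insert ((10 + Real.exp t) • EuclideanSpace.single (1 : Fin 3) (1 : ℝ))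
        (insert (-((10 + Real.exp t) • EuclideanSpace.single (1 : Fin 3) (1 : ℝ))) (comb m))) :
          Set (EuclideanSpace ℝ (Fin 3))),
      x ≠ y → 1 / (2 * ((m : ℝ) + 1)) ≤ dist x y := by
  have hδ : 1 / (2 * ((m : ℝ) + 1)) ≤ 8 := by
    rw [div_le_iff₀ (by positivity)]
    have : (0 : ℝ) ≤ m := by positivity
    linarith
  have hfar : ‖(10 + Real.exp t) • EuclideanSpace.single (1 : Fin 3) (1 : ℝ)‖ = 10 + Real.exp t :=
    norm_far t
  have hnfar : ‖-((10 + Real.exp t) • EuclideanSpace.single (1 : Fin 3) (1 : ℝ))‖ =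
      10 + Real.exp t := by rw [norm_neg, norm_far]
  intro x hx y hy hxy
  rw [Finset.mem_coe, mem_combPair_iff] at hx hy
  rcases hx with rfl | rfl | hx <;> rcases hy with rfl | rfl | hy
  · exact absurd rfl hxy
  · rw [dist_far_neg_far]; linarith [ten_lt_far t]
  · exact hδ.trans (eight_le_dist_far_comb t hfar hy)
  · rw [dist_comm, dist_far_neg_far]; linarith [ten_lt_far t]
  · exact absurd rfl hxy
  · exact hδ.trans (eight_le_dist_far_comb t hnfar hy)
  · rw [dist_comm]; exact hδ.trans (eight_le_dist_far_comb t hfar hx)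
  · rw [dist_comm]; exact hδ.trans (eight_le_dist_far_comb t hnfar hx)
  · exact comb_separated m x hx y hy hxy

/-- The decorated comb as a rooted hard-core configuration (proof obligation of
`RootedHardCoreConfig`). [folklore] -/
theorem combPair_rooted_separated (t : ℝ) (m : ℕ) :
    (0 : EuclideanSpace ℝ (Fin 3)) ∈ (LocalConfig.mk (↑(insert ((10 + Real.exp t) •
        EuclideanSpace.single (1 : Fin 3) (1 : ℝ)) (insert (-((10 + Real.exp t) •
          EuclideanSpace.single (1 : Fin 3) (1 : ℝ))) (comb m))) : Set (EuclideanSpace ℝ (Fin 3))) :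
            LocalConfig (EuclideanSpace ℝ (Fin 3))) ∧
      ∀ x ∈ (LocalConfig.mk (↑(insert ((10 + Real.exp t) •
        EuclideanSpace.single (1 : Fin 3) (1 : ℝ)) (insert (-((10 + Real.exp t) •
          EuclideanSpace.single (1 : Fin 3) (1 : ℝ))) (comb m))) : Set (EuclideanSpace ℝ (Fin 3))) :
            LocalConfig (EuclideanSpace ℝ (Fin 3))),
      ∀ y ∈ (LocalConfig.mk (↑(insert ((10 + Real.exp t) •
        EuclideanSpace.single (1 : Fin 3) (1 : ℝ)) (insert (-((10 + Real.exp t) •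
          EuclideanSpace.single (1 : Fin 3) (1 : ℝ))) (comb m))) : Set (EuclideanSpace ℝ (Fin 3))) :
            LocalConfig (EuclideanSpace ℝ (Fin 3))), x ≠ y → 1 / (2 * ((m : ℝ) + 1)) ≤ dist x y :=
  ⟨by
    change (0 : EuclideanSpace ℝ (Fin 3)) ∈ (↑(insert _ (insert _ (comb m))) : Set _)
    rw [Finset.mem_coe, mem_combPair_iff]
    exact Or.inr (Or.inr (by simp [comb])), combPair_separated t m⟩

/-! ## §2 The diameter separates the family; continuity -/

/-- **The diameter of the decorated comb is `2(10 + eᵗ)`.** [folklore] -/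
theorem diam_combPair (t : ℝ) (m : ℕ) :
    Metric.diam (↑(insert ((10 + Real.exp t) • EuclideanSpace.single (1 : Fin 3) (1 : ℝ))
        (insert (-((10 + Real.exp t) • EuclideanSpace.single (1 : Fin 3) (1 : ℝ))) (comb m))) :
          Set (EuclideanSpace ℝ (Fin 3))) = 2 * (10 + Real.exp t) := by
  have hfar : ‖(10 + Real.exp t) • EuclideanSpace.single (1 : Fin 3) (1 : ℝ)‖ = 10 + Real.exp t :=
    norm_far t
  have hnfar : ‖-((10 + Real.exp t) • EuclideanSpace.single (1 : Fin 3) (1 : ℝ))‖ =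
      10 + Real.exp t := by rw [norm_neg, norm_far]
  have het := ten_lt_far t
  refine le_antisymm (Metric.diam_le_of_forall_dist_le (by positivity) fun x hx y hy => ?_) ?_
  · have key : ∀ x y : EuclideanSpace ℝ (Fin 3), ‖x‖ ≤ 10 + Real.exp t → ‖y‖ ≤ 10 + Real.exp t →
        dist x y ≤ 2 * (10 + Real.exp t) := fun x y hx hy => by
      rw [dist_eq_norm]
      linarith [norm_sub_le x y]
    have hb : ∀ z ∈ (↑(insert ((10 + Real.exp t) • EuclideanSpace.single (1 : Fin 3) (1 : ℝ))
        (insert (-((10 + Real.exp t) • EuclideanSpace.single (1 : Fin 3) (1 : ℝ))) (comb m))) :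
          Set (EuclideanSpace ℝ (Fin 3))), ‖z‖ ≤ 10 + Real.exp t := by
      intro z hz
      rw [Finset.mem_coe, mem_combPair_iff] at hz
      rcases hz with rfl | rfl | hz
      · exact hfar.le
      · exact hnfar.le
      · linarith [norm_le_two_of_mem_comb hz]
    exact key x y (hb x hx) (hb y hy)
  · rw [← dist_far_neg_far t]
    refine Metric.dist_le_diam_of_mem (Finset.finite_toSet _).isBounded ?_ ?_
    · rw [Finset.mem_coe, mem_combPair_iff]; exact Or.inl rfl
    · rw [Finset.mem_coe, mem_combPair_iff]; exact Or.inr (Or.inl rfl)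

/-- **The family is continuous in the local rubber metric**: match the comb by the identity and
the far points index-wise (`|eᵗ − e^{t₀}|` apart). [folklore] -/
theorem continuous_mk_combPair (m : ℕ) :
    Continuous fun t : ℝ => (LocalConfig.mk (↑(insert ((10 + Real.exp t) •
        EuclideanSpace.single (1 : Fin 3) (1 : ℝ)) (insert (-((10 + Real.exp t) •
          EuclideanSpace.single (1 : Fin 3) (1 : ℝ))) (comb m))) : Set (EuclideanSpace ℝ (Fin 3))) :
            LocalConfig (EuclideanSpace ℝ (Fin 3))) := by
  have h1 : ‖EuclideanSpace.single (1 : Fin 3) (1 : ℝ)‖ = 1 := by simp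
  have hdf : ∀ t t' : ℝ, dist ((10 + Real.exp t) • EuclideanSpace.single (1 : Fin 3) (1 : ℝ))
      ((10 + Real.exp t') • EuclideanSpace.single (1 : Fin 3) (1 : ℝ)) = |Real.exp t - Real.exp t'| :=
    fun t t' => by
      rw [dist_eq_norm, ← sub_smul, norm_smul, h1, mul_one, Real.norm_eq_abs]
      congr 1; ring
  have hdn : ∀ t t' : ℝ, dist (-((10 + Real.exp t) • EuclideanSpace.single (1 : Fin 3) (1 : ℝ)))
      (-((10 + Real.exp t') • EuclideanSpace.single (1 : Fin 3) (1 : ℝ))) =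
        |Real.exp t - Real.exp t'| := fun t t' => by rw [dist_neg_neg, hdf]
  refine Metric.continuous_iff.2 fun t₀ ε hε => ?_
  set ε₁ : ℝ := min ε 1 with hε₁def
  have hε₁ : 0 < ε₁ := lt_min hε one_pos
  have hε₁ε : ε₁ ≤ ε := min_le_left _ _
  obtain ⟨η, hη, hηs⟩ := Metric.continuous_iff.1 Real.continuous_exp t₀ (ε₁ / 2) (by positivity)
  refine ⟨η, hη, fun t ht => ?_⟩
  have hst : |Real.exp t - Real.exp t₀| < ε₁ / 2 := by
    have := hηs t ht
    rwa [Real.dist_eq] at this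
  have hm : LocallyMatches (ε₁ / 2)⁻¹ (ε₁ / 2)
      (↑(insert ((10 + Real.exp t) • EuclideanSpace.single (1 : Fin 3) (1 : ℝ))
        (insert (-((10 + Real.exp t) • EuclideanSpace.single (1 : Fin 3) (1 : ℝ))) (comb m))) :
          Set (EuclideanSpace ℝ (Fin 3)))
      (↑(insert ((10 + Real.exp t₀) • EuclideanSpace.single (1 : Fin 3) (1 : ℝ))
        (insert (-((10 + Real.exp t₀) • EuclideanSpace.single (1 : Fin 3) (1 : ℝ))) (comb m))) :
          Set (EuclideanSpace ℝ (Fin 3))) := by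
    refine ⟨fun p hp _ => ?_, fun q hq _ => ?_⟩
    · rw [Finset.mem_coe, mem_combPair_iff] at hp
      rcases hp with rfl | rfl | hp
      · refine ⟨_, by rw [Finset.mem_coe, mem_combPair_iff]; exact Or.inl rfl, ?_⟩
        rw [hdf]; exact hst.le
      · refine ⟨_, by rw [Finset.mem_coe, mem_combPair_iff]; exact Or.inr (Or.inl rfl), ?_⟩
        rw [hdn]; exact hst.le
      · exact ⟨p, by rw [Finset.mem_coe, mem_combPair_iff]; exact Or.inr (Or.inr hp),
          by rw [dist_self]; positivity⟩
    · rw [Finset.mem_coe, mem_combPair_iff] at hq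
      rcases hq with rfl | rfl | hq
      · refine ⟨_, by rw [Finset.mem_coe, mem_combPair_iff]; exact Or.inl rfl, ?_⟩
        rw [hdf]; exact hst.le
      · refine ⟨_, by rw [Finset.mem_coe, mem_combPair_iff]; exact Or.inr (Or.inl rfl), ?_⟩
        rw [hdn]; exact hst.le
      · exact ⟨q, by rw [Finset.mem_coe, mem_combPair_iff]; exact Or.inr (Or.inr hq),
          by rw [dist_self]; positivity⟩
  have hd : dist (LocalConfig.mk (↑(insert ((10 + Real.exp t) •
        EuclideanSpace.single (1 : Fin 3) (1 : ℝ)) (insert (-((10 + Real.exp t) •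
          EuclideanSpace.single (1 : Fin 3) (1 : ℝ))) (comb m))) : Set (EuclideanSpace ℝ (Fin 3))) :
            LocalConfig (EuclideanSpace ℝ (Fin 3)))
      (LocalConfig.mk (↑(insert ((10 + Real.exp t₀) •
        EuclideanSpace.single (1 : Fin 3) (1 : ℝ)) (insert (-((10 + Real.exp t₀) •
          EuclideanSpace.single (1 : Fin 3) (1 : ℝ))) (comb m))) : Set (EuclideanSpace ℝ (Fin 3)))) ≤
      ε₁ / 2 :=
    dist_le_of_locallyMatches (by positivity : (0 : ℝ) < ε₁ / 2) hm
  exact lt_of_le_of_lt hd (by linarith)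

/-- **`t ↦ count|(comb ∪ {±(10 + eᵗ)e₁})` is a measurable embedding of `ℝ` into `Measure ℝ³`.**
[folklore] -/
theorem measurableEmbedding_combPair (m : ℕ) :
    MeasurableEmbedding fun t : ℝ => (Measure.count : Measure (EuclideanSpace ℝ (Fin 3))).restrict
      (↑(insert ((10 + Real.exp t) • EuclideanSpace.single (1 : Fin 3) (1 : ℝ))
        (insert (-((10 + Real.exp t) • EuclideanSpace.single (1 : Fin 3) (1 : ℝ))) (comb m))) :
          Set (EuclideanSpace ℝ (Fin 3))) := by
  have hδ : (0 : ℝ) < 1 / (2 * ((m : ℝ) + 1)) := by positivity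
  haveI : Fact ((0 : ℝ) < 1 / (2 * ((m : ℝ) + 1))) := ⟨hδ⟩
  set f : ℝ → RootedHardCoreConfig (EuclideanSpace ℝ (Fin 3)) (1 / (2 * ((m : ℝ) + 1))) := fun t =>
    ⟨LocalConfig.mk (↑(insert ((10 + Real.exp t) • EuclideanSpace.single (1 : Fin 3) (1 : ℝ))
        (insert (-((10 + Real.exp t) • EuclideanSpace.single (1 : Fin 3) (1 : ℝ))) (comb m))) :
          Set (EuclideanSpace ℝ (Fin 3))), combPair_rooted_separated t m⟩ with hf
  have hcont : Continuous f := (continuous_mk_combPair m).subtype_mk _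
  have hinj : Injective f := by
    intro t₁ t₂ h
    have hset := congrArg
      (fun S : RootedHardCoreConfig (EuclideanSpace ℝ (Fin 3)) (1 / (2 * ((m : ℝ) + 1))) =>
        Metric.diam (((S.1 : LocalConfig (EuclideanSpace ℝ (Fin 3))) :
          Set (EuclideanSpace ℝ (Fin 3))))) h
    simp only [hf, coe_mk, diam_combPair] at hset
    exact Real.exp_injective (by linarith)
  exact measurableEmbedding_count_restrict_of_continuous f hcont hinj

/-! ## §3 The energy of the root -/

/-- **Root energy of the decorated comb**: `h = V_LJ(10 + eᵗ) + h(comb) ≤ e*` — the far pair only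
adds a non-positive term. [folklore] -/
theorem rootEnergy_combPair_le (t : ℝ) :
    rootEnergy lennardJones ((Measure.count : Measure (EuclideanSpace ℝ (Fin 3))).restrict
      (↑(insert ((10 + Real.exp t) • EuclideanSpace.single (1 : Fin 3) (1 : ℝ))
        (insert (-((10 + Real.exp t) • EuclideanSpace.single (1 : Fin 3) (1 : ℝ))) (comb combSize))) :
          Set (EuclideanSpace ℝ (Fin 3)))) ≤
      ⨅ Q : PeriodicConfiguration 3, Q.energyPerParticle lennardJones := by
  have hcomb := rootEnergy_comb_le_eStar
  have hV : lennardJones (10 + Real.exp t) ≤ 0 := lennardJones_nonpos (by linarith [ten_lt_far t])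
  rw [rootEnergy_count_restrict_coe_finset, Finset.sum_insert (far_not_mem_insert t combSize),
    Finset.sum_insert (neg_far_not_mem_comb t combSize), norm_neg, norm_far]
  have : (lennardJones (10 + Real.exp t) + (lennardJones (10 + Real.exp t) +
      ∑ x ∈ comb combSize, lennardJones ‖x‖)) / 2 =
        lennardJones (10 + Real.exp t) + (∑ x ∈ comb combSize, lennardJones ‖x‖) / 2 := by ring
  rw [this]
  rw [integral_count_restrict_coe_finset] at hcomb
  change lennardJones (10 + Real.exp t) + (∑ x ∈ comb combSize, lennardJones ‖x‖) / 2 ≤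
    Summit.AtomisticToContinuum.Crystallization.Theorems.MinimiserShells.Negative.LoadBearing.eStar
  linarith

/-- The root energy along the family is measurable in the parameter (`V_LJ` is measurable, the comb
term is constant). [folklore] -/
theorem measurable_rootEnergy_combPair :
    Measurable fun t : ℝ => rootEnergy lennardJones
      ((Measure.count : Measure (EuclideanSpace ℝ (Fin 3))).restrict
        (↑(insert ((10 + Real.exp t) • EuclideanSpace.single (1 : Fin 3) (1 : ℝ))
          (insert (-((10 + Real.exp t) • EuclideanSpace.single (1 : Fin 3) (1 : ℝ)))
            (comb combSize))) : Set (EuclideanSpace ℝ (Fin 3)))) := by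
  have hfun : (fun t : ℝ => rootEnergy lennardJones
      ((Measure.count : Measure (EuclideanSpace ℝ (Fin 3))).restrict
        (↑(insert ((10 + Real.exp t) • EuclideanSpace.single (1 : Fin 3) (1 : ℝ))
          (insert (-((10 + Real.exp t) • EuclideanSpace.single (1 : Fin 3) (1 : ℝ)))
            (comb combSize))) : Set (EuclideanSpace ℝ (Fin 3))))) =
      fun t => lennardJones (10 + Real.exp t) + (∑ x ∈ comb combSize, lennardJones ‖x‖) / 2 := by
    funext t
    rw [rootEnergy_count_restrict_coe_finset, Finset.sum_insert (far_not_mem_insert t combSize),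
      Finset.sum_insert (neg_far_not_mem_comb t combSize), norm_neg, norm_far]
    ring
  rw [hfun]
  have hm : Measurable lennardJones := by
    unfold lennardJones
    exact ((measurable_inv.pow_const 12).const_mul _).sub ((measurable_inv.pow_const 6).const_mul _)
  exact (hm.comp (measurable_const.add Real.measurable_exp)).add measurable_const

/-- The root energy along the family is bounded: `|h| ≤ 1/12 + |h(comb)|`. [folklore] -/
theorem abs_rootEnergy_combPair_le (t : ℝ) :
    |rootEnergy lennardJones ((Measure.count : Measure (EuclideanSpace ℝ (Fin 3))).restrict
      (↑(insert ((10 + Real.exp t) • EuclideanSpace.single (1 : Fin 3) (1 : ℝ))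
        (insert (-((10 + Real.exp t) • EuclideanSpace.single (1 : Fin 3) (1 : ℝ))) (comb combSize))) :
          Set (EuclideanSpace ℝ (Fin 3))))| ≤
      1 / 12 + |(∑ x ∈ comb combSize, lennardJones ‖x‖) / 2| := by
  rw [rootEnergy_count_restrict_coe_finset, Finset.sum_insert (far_not_mem_insert t combSize),
    Finset.sum_insert (neg_far_not_mem_comb t combSize), norm_neg, norm_far]
  have : (lennardJones (10 + Real.exp t) + (lennardJones (10 + Real.exp t) +
      ∑ x ∈ comb combSize, lennardJones ‖x‖)) / 2 =
        lennardJones (10 + Real.exp t) + (∑ x ∈ comb combSize, lennardJones ‖x‖) / 2 := by ring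
  rw [this]
  have hV0 : lennardJones (10 + Real.exp t) ≤ 0 := lennardJones_nonpos (by linarith [ten_lt_far t])
  have hV1 : -1 / 12 ≤ lennardJones (10 + Real.exp t) := neg_one_div_le_lennardJones _
  have hV : |lennardJones (10 + Real.exp t)| ≤ 1 / 12 := by
    rw [abs_le]; constructor <;> linarith
  exact (abs_add_le _ _).trans (by linarith)

/-! ## §4 Point-stationarity is load-bearing -/

/-- **Point-stationarity is load-bearing** (`MinimisingLawsHaveAtoms` WITHOUT the Mecke /
mass-transport identity, stated inline, is FALSE): the law of the decorated comb family is an a.s.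
`δ`-hard-core probability law (`δ = 1/(2(combSize+1))`) with `E[h] ≤ e*` charging no rooted
isometry class. [folklore] -/
theorem minimisingLawsHaveAtoms_false_without_pointStationarity :
    ¬ (∀ δ : ℝ, 0 < δ → ∀ P : Measure (Measure (EuclideanSpace ℝ (Fin 3))), IsProbabilityMeasure P →
      (∀ᵐ μ ∂P, IsRootedHardCore δ μ) →
      (∫ μ, rootEnergy lennardJones μ ∂P) ≤
        (⨅ Q : PeriodicConfiguration 3, Q.energyPerParticle lennardJones) →
      ∃ Y : Set (EuclideanSpace ℝ (Fin 3)), 0 < P {μ | ∃ A : EuclideanSpace ℝ (Fin 3) →ₗᵢ[ℝ]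
        EuclideanSpace ℝ (Fin 3), ∃ q ∈ Y, μ = (Measure.count : Measure
          (EuclideanSpace ℝ (Fin 3))).restrict ((fun s => A (s - q)) '' Y)}) := by
  intro H
  have hδ : (0 : ℝ) < 1 / (2 * ((combSize : ℝ) + 1)) := by positivity
  have hE := measurableEmbedding_combPair combSize
  set P : Measure (Measure (EuclideanSpace ℝ (Fin 3))) := ((volume : Measure ℝ).restrict
    (Icc 0 1)).map fun t : ℝ => (Measure.count : Measure (EuclideanSpace ℝ (Fin 3))).restrict
      (↑(insert ((10 + Real.exp t) • EuclideanSpace.single (1 : Fin 3) (1 : ℝ))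
        (insert (-((10 + Real.exp t) • EuclideanSpace.single (1 : Fin 3) (1 : ℝ))) (comb combSize))) :
          Set (EuclideanSpace ℝ (Fin 3))) with hP
  haveI hvol : IsProbabilityMeasure ((volume : Measure ℝ).restrict (Icc 0 1)) :=
    ⟨by rw [Measure.restrict_apply_univ, Real.volume_Icc]; simp⟩
  haveI : IsProbabilityMeasure P := Measure.isProbabilityMeasure_map hE.measurable.aemeasurable
  have hhc : ∀ᵐ μ ∂P, IsRootedHardCore (1 / (2 * ((combSize : ℝ) + 1))) μ :=
    ae_isRootedHardCore_map_family hE fun t =>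
      ⟨_, (combPair_rooted_separated t combSize).1, combPair_separated t combSize, rfl⟩
  have hEn : (∫ μ, rootEnergy lennardJones μ ∂P) ≤
      ⨅ Q : PeriodicConfiguration 3, Q.energyPerParticle lennardJones := by
    rw [hP, integral_map_family hE]
    have hint : Integrable (fun t : ℝ => rootEnergy lennardJones
        ((Measure.count : Measure (EuclideanSpace ℝ (Fin 3))).restrict
          (↑(insert ((10 + Real.exp t) • EuclideanSpace.single (1 : Fin 3) (1 : ℝ))
            (insert (-((10 + Real.exp t) • EuclideanSpace.single (1 : Fin 3) (1 : ℝ)))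
              (comb combSize))) : Set (EuclideanSpace ℝ (Fin 3)))))
        ((volume : Measure ℝ).restrict (Icc 0 1)) :=
      (integrable_const (1 / 12 + |(∑ x ∈ comb combSize, lennardJones ‖x‖) / 2|)).mono'
        measurable_rootEnergy_combPair.aestronglyMeasurable
        (Eventually.of_forall fun t => by
          rw [Real.norm_eq_abs]; exact abs_rootEnergy_combPair_le t)
    calc _ ≤ ∫ _t, (⨅ Q : PeriodicConfiguration 3, Q.energyPerParticle lennardJones)
          ∂((volume : Measure ℝ).restrict (Icc 0 1)) :=
          integral_mono hint (integrable_const _) fun t => rootEnergy_combPair_le t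
      _ = ⨅ Q : PeriodicConfiguration 3, Q.energyPerParticle lennardJones := by
          rw [integral_const, probReal_univ, one_smul]
  obtain ⟨Y, hY⟩ := H _ hδ P inferInstance hhc hEn
  refine hY.ne' ?_
  rw [hP]
  exact map_family_rootedClass_eq_zero hE Metric.diam (fun φ hφ X => hφ.diam_image X)
    (fun t₁ t₂ h => Real.exp_injective (by
      simp only [diam_combPair] at h
      linarith)) Y

end Summit.AtomisticToContinuum.Crystallization.Theorems.MinimisingLawsHaveAtoms.Negative.RootedCombPair

end
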